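import Summits.QuantumFields.YangMills.Theorems.LuscherReductionTwistedTraceScalingBOStiffSep
import Summits.QuantumFields.YangMills.Theorems.LuscherReductionTwistedTraceScalingBTTails
import HarnessLib

/-!
# (C5-α′, pointwise) STIFF SEPARATION IN RECORD COORDINATES: `K̃_β(U, V) ≤ e^{2β|E|}·e^{−β(r_f/1000)²}` for `U` in the outer gauge-near region and `V` in the inner gauge-near tube,
# from six explicit numerical conditions on the schedule
# (lane A of S-BASE, crux `TwistedTraceScaling` stmt-QuantumFields-20203, C4-CORE, the (OD) pen; `pub/ym-fleet/ym-luscher-20007-p1/HANDOFF-g20.md` (α′))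

`…BOStiffSep.avgKernel_le_of_stiffSep` with the record choices `d = r_F/1000`, `ω = r_F/24` (inner tube radius `‖x̂‖ ≤ r_F/24`), `τ_u = δ` (slow window of `V`), `m = δ + δ'`
(`δ'` the slow window of `U`), `a = √2·r_F/24 + δ` (`…BTTails.norm_su2Quat_orthoTube_sub_one_le`), `a' = a_U` (link radius of `U`), and the outer threshold `‖x̂'‖ > r_F/12`:
★★★ `avgKernel_le_of_stiffSep_record` — if `r_F/24 ≤ 1/20`, `δ ≤ 1`, `12√(3|E|)δC_P ≤ 1/2`, `3L(r_F/1000 + a_U + √2r_F/24 + δ) ≤ 1/40`, `2g₁ ≤ 1/40` and the bootstrap radius at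
`‖x̂‖ = r_F/24` is `≤ (r_F/12)²`, then `K̃_β(oT u' x', oT u x) ≤ e^{2β|E|}e^{−β(r_F/1000)²}` for all such pairs.  On schedule B (`r_F = r_f(β)`, `τ = β^{-1}ℓ`, `δ = recordDelta1`,
`δ' = 517β^{-s}/|Site|`, `a_U = 43Mβ^{-s}`) the six conditions hold eventually for `s > 1/6` (next file): this is `hsep` of `…BODefectOutPiece` with `K_sep = e^{2β|E|}e^{−βr_f²/10⁶}`.
HONEST FRAMING: bookkeeping for a stub of a child of the CONDITIONAL route R2b1; the eventual schedule check, the hOD assembly, (B-ST), C4-CORE OPEN; not a gap, not Clay.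
-/

set_option autoImplicit false

noncomputable section

open Real
open scoped BigOperators Matrix Quaternion RealInnerProductSpace
open Literature.MathematicalPhysics.QuantumFieldTheory
open Literature.MathematicalPhysics.QuantumLattice

namespace Summit.QuantumFields.YangMills.Theorems.FemtoTransferGap.TwoLattice.ConstTube

open Summit.QuantumFields.YangMills.Theorems.FemtoTransferGap
open Summit.QuantumFields.YangMills.Theorems.FemtoTransferGap.TwoLattice
open Summit.QuantumFields.YangMills.Theorems.FemtoTransferGap.TwoLattice.Avg
open Summit.QuantumFields.YangMills.Theorems.FemtoTransferGap.TwoLattice.Stiff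
open Summit.QuantumFields.YangMills.Theorems.FemtoTransferGap.TwoLattice.Toron
open Summit.QuantumFields.YangMills.Theorems.FemtoTransferGap.TwoLattice.Cov

variable {L : ℕ} [NeZero L]

set_option maxHeartbeats 1600000 in
-- the explicit two-round bootstrap radius (~2k characters) is instantiated and compared; the default budget is exceeded.
/-- ★★★ **STIFF SEPARATION IN RECORD COORDINATES** (see the module docstring). [cite: Luscher1983, §3] -/
theorem avgKernel_le_of_stiffSep_record {β : ℝ} (hβ : 0 ≤ β) {C : ℝ} (hC : 0 < C)
    (hP : ∀ ξ : Site 3 L → Fin 3 → ℝ, ∑ y : Site 3 L, ξ y = 0 → ‖ξ‖ ≤ C * ‖vacGrad L ξ‖)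
    {rF τ δ δ' aU : ℝ} (hrF0 : 0 ≤ rF) (hrF : rF / 24 ≤ 1 / 20) (hτ0 : 0 ≤ τ) (hδ0 : 0 ≤ δ) (hδ1 : δ ≤ 1) (hδ'0 : 0 ≤ δ') (haU : 0 ≤ aU)
    (hsmall : 12 * Real.sqrt (3 * Fintype.card (Edge 3 L)) * δ * C ≤ 1 / 2)
    (hϑ1 : 3 * L * ((rF / 1000) + aU + (Real.sqrt 2 * (rF / 24) + δ)) ≤ 1 / 40)
    (hg₁ : 2 * (2 * C * (2 * τ + (Real.sqrt 6 * (rF / 1000) + Real.sqrt (6 * Fintype.card (Edge 3 L)) * ((40 * (4 * (3 * L * ((rF / 1000) + aU + (Real.sqrt 2 * (rF / 24) + δ))) ^ 2 + 2 * (3 * L * ((rF / 1000) + aU + (Real.sqrt 2 * (rF / 24) + δ))) * (rF / 24)) + 12 * δ * (3 * L * ((rF / 1000) + aU + (Real.sqrt 2 * (rF / 24) + δ)))) + 4 * (6 * (3 * L * ((rF / 1000) + aU + (Real.sqrt 2 * (rF / 24) + δ))) + 2 * (rF / 24)) * (δ + δ'))))) ≤ 1 / 40)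
    (hB : τ ^ 2 + ((rF / 24) + 4 * τ + 4 * (Real.sqrt 6 * (rF / 1000) + Real.sqrt (6 * Fintype.card (Edge 3 L)) *
      ((40 * (4 * (2 * (2 * C * (2 * τ + (Real.sqrt 6 * (rF / 1000) + Real.sqrt (6 * Fintype.card (Edge 3 L)) * ((40 * (4 * (3 * L * ((rF / 1000) + aU + (Real.sqrt 2 * (rF / 24) + δ))) ^ 2 + 2 * (3 * L * ((rF / 1000) + aU + (Real.sqrt 2 * (rF / 24) + δ))) * (rF / 24)) + 12 * δ * (3 * L * ((rF / 1000) + aU + (Real.sqrt 2 * (rF / 24) + δ)))) + 4 * (6 * (3 * L * ((rF / 1000) + aU + (Real.sqrt 2 * (rF / 24) + δ))) + 2 * (rF / 24)) * (δ + δ')))))) ^ 2 +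
          2 * (2 * (2 * C * (2 * τ + (Real.sqrt 6 * (rF / 1000) + Real.sqrt (6 * Fintype.card (Edge 3 L)) * ((40 * (4 * (3 * L * ((rF / 1000) + aU + (Real.sqrt 2 * (rF / 24) + δ))) ^ 2 + 2 * (3 * L * ((rF / 1000) + aU + (Real.sqrt 2 * (rF / 24) + δ))) * (rF / 24)) + 12 * δ * (3 * L * ((rF / 1000) + aU + (Real.sqrt 2 * (rF / 24) + δ)))) + 4 * (6 * (3 * L * ((rF / 1000) + aU + (Real.sqrt 2 * (rF / 24) + δ))) + 2 * (rF / 24)) * (δ + δ')))))) * (rF / 24)) +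
        12 * δ * (2 * C * (2 * τ + (Real.sqrt 6 * (rF / 1000) + Real.sqrt (6 * Fintype.card (Edge 3 L)) * ((40 * (4 * (3 * L * ((rF / 1000) + aU + (Real.sqrt 2 * (rF / 24) + δ))) ^ 2 + 2 * (3 * L * ((rF / 1000) + aU + (Real.sqrt 2 * (rF / 24) + δ))) * (rF / 24)) + 12 * δ * (3 * L * ((rF / 1000) + aU + (Real.sqrt 2 * (rF / 24) + δ)))) + 4 * (6 * (3 * L * ((rF / 1000) + aU + (Real.sqrt 2 * (rF / 24) + δ))) + 2 * (rF / 24)) * (δ + δ')))))) +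
        4 * (6 * (2 * (2 * C * (2 * τ + (Real.sqrt 6 * (rF / 1000) + Real.sqrt (6 * Fintype.card (Edge 3 L)) * ((40 * (4 * (3 * L * ((rF / 1000) + aU + (Real.sqrt 2 * (rF / 24) + δ))) ^ 2 + 2 * (3 * L * ((rF / 1000) + aU + (Real.sqrt 2 * (rF / 24) + δ))) * (rF / 24)) + 12 * δ * (3 * L * ((rF / 1000) + aU + (Real.sqrt 2 * (rF / 24) + δ)))) + 4 * (6 * (3 * L * ((rF / 1000) + aU + (Real.sqrt 2 * (rF / 24) + δ))) + 2 * (rF / 24)) * (δ + δ')))))) + 2 * (rF / 24)) * (δ + δ')))) ^ 2 ≤ (rF / 12) ^ 2)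
    {u u' : GaugeConfig 3 1 SU2} {x x' : Edge 3 L → Fin 3 → ℝ} (hx : x ∈ capBalancedSet L) (hx' : x' ∈ capBalancedSet L)
    (hU : ∀ e, ‖su2Quat (orthoTube L u' x' e) - 1‖ ≤ aU) (hu' : ∀ k : Fin 3, ‖su2Quat (u' (0, k)) - 1‖ ≤ δ') (hu : ∀ k : Fin 3, ‖su2Quat (u (0, k)) - 1‖ ≤ δ)
    (hfar : rF / 12 < ‖linkEmbed L x'‖) (hτx' : ‖(gaugeModes L).starProjection (linkEmbed L x')‖ ≤ τ)
    (hin : ‖linkEmbed L x‖ ≤ rF / 24) (hτx : ‖(gaugeModes L).starProjection (linkEmbed L x)‖ ≤ τ) :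
    avgKernel β (orthoTube L u' x') (orthoTube L u x) ≤ Real.exp (2 * β) ^ Fintype.card (Edge 3 L) * Real.exp (-(β * (rF / 1000) ^ 2)) := by
  have hE0 : (0 : ℝ) ≤ Real.sqrt (6 * Fintype.card (Edge 3 L)) := Real.sqrt_nonneg _
  have h6 : (0 : ℝ) ≤ Real.sqrt 6 := Real.sqrt_nonneg _
  have hL0 : (0 : ℝ) ≤ (L : ℝ) := Nat.cast_nonneg _
  have hx1 : ∀ e, ∑ a, x e a ^ 2 ≤ 1 := fun e => (hx.2 e).trans (by norm_num)
  -- the hypotheses of the abstract theorem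
  have ha : ∀ e, ‖su2Quat (orthoTube L u x e) - 1‖ ≤ Real.sqrt 2 * (rF / 24) + δ := fun e =>
    (norm_su2Quat_orthoTube_sub_one_le u hx1 e).trans (add_le_add (mul_le_mul_of_nonneg_left hin (Real.sqrt_nonneg _)) (hu e.2))
  have hω : ∀ e, ‖x e‖ ≤ rF / 24 := fun e =>
    (pi_norm_le_iff_of_nonneg (by linarith)).mpr fun c => by
      rw [Real.norm_eq_abs]
      have h := abs_apply_le_norm (linkEmbed L x) e c
      rw [linkEmbed_apply] at h
      exact h.trans hin
  have huv : ∀ (k : Fin 3) (c : Fin 3), |vecPart (u (0, k)) c| ≤ δ := fun k c => (abs_vecPart_le_norm_sub_one _ c).trans (hu k)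
  have hm : ∀ k : Fin 3, ‖su2Quat (u (0, k)) - 1‖ + ‖su2Quat (u' (0, k)) - 1‖ ≤ δ + δ' := fun k => add_le_add (hu k) (hu' k)
  have hd : (0 : ℝ) ≤ rF / 1000 := by positivity
  -- monotonicity of the radius in `‖x̂‖`
  have hx0 : 0 ≤ ‖linkEmbed L x‖ := norm_nonneg _
  have hBact : τ ^ 2 + (‖linkEmbed L x‖ + 4 * τ + 4 * (Real.sqrt 6 * (rF / 1000) + Real.sqrt (6 * Fintype.card (Edge 3 L)) *
      ((40 * (4 * (2 * (2 * C * (2 * τ + (Real.sqrt 6 * (rF / 1000) + Real.sqrt (6 * Fintype.card (Edge 3 L)) * ((40 * (4 * (3 * L * ((rF / 1000) + aU + (Real.sqrt 2 * (rF / 24) + δ))) ^ 2 + 2 * (3 * L * ((rF / 1000) + aU + (Real.sqrt 2 * (rF / 24) + δ))) * (rF / 24)) + 12 * δ * (3 * L * ((rF / 1000) + aU + (Real.sqrt 2 * (rF / 24) + δ)))) + 4 * (6 * (3 * L * ((rF / 1000) + aU + (Real.sqrt 2 * (rF / 24) + δ))) + 2 * (rF / 24)) * (δ + δ')))))) ^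 2 +
          2 * (2 * (2 * C * (2 * τ + (Real.sqrt 6 * (rF / 1000) + Real.sqrt (6 * Fintype.card (Edge 3 L)) * ((40 * (4 * (3 * L * ((rF / 1000) + aU + (Real.sqrt 2 * (rF / 24) + δ))) ^ 2 + 2 * (3 * L * ((rF / 1000) + aU + (Real.sqrt 2 * (rF / 24) + δ))) * (rF / 24)) + 12 * δ * (3 * L * ((rF / 1000) + aU + (Real.sqrt 2 * (rF / 24) + δ)))) + 4 * (6 * (3 * L * ((rF / 1000) + aU + (Real.sqrt 2 * (rF / 24) + δ))) + 2 * (rF / 24)) * (δ + δ')))))) * (rF / 24)) +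
        12 * δ * (2 * C * (2 * τ + (Real.sqrt 6 * (rF / 1000) + Real.sqrt (6 * Fintype.card (Edge 3 L)) * ((40 * (4 * (3 * L * ((rF / 1000) + aU + (Real.sqrt 2 * (rF / 24) + δ))) ^ 2 + 2 * (3 * L * ((rF / 1000) + aU + (Real.sqrt 2 * (rF / 24) + δ))) * (rF / 24)) + 12 * δ * (3 * L * ((rF / 1000) + aU + (Real.sqrt 2 * (rF / 24) + δ)))) + 4 * (6 * (3 * L * ((rF / 1000) + aU + (Real.sqrt 2 * (rF / 24) + δ))) + 2 * (rF / 24)) * (δ + δ')))))) +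
        4 * (6 * (2 * (2 * C * (2 * τ + (Real.sqrt 6 * (rF / 1000) + Real.sqrt (6 * Fintype.card (Edge 3 L)) * ((40 * (4 * (3 * L * ((rF / 1000) + aU + (Real.sqrt 2 * (rF / 24) + δ))) ^ 2 + 2 * (3 * L * ((rF / 1000) + aU + (Real.sqrt 2 * (rF / 24) + δ))) * (rF / 24)) + 12 * δ * (3 * L * ((rF / 1000) + aU + (Real.sqrt 2 * (rF / 24) + δ)))) + 4 * (6 * (3 * L * ((rF / 1000) + aU + (Real.sqrt 2 * (rF / 24) + δ))) + 2 * (rF / 24)) * (δ + δ')))))) + 2 * (rF / 24)) * (δ + δ')))) ^ 2 < ‖linkEmbed L x'‖ ^ 2 := by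
    have h12 : (rF / 12) ^ 2 < ‖linkEmbed L x'‖ ^ 2 := pow_lt_pow_left₀ hfar (by positivity) two_ne_zero
    refine lt_of_le_of_lt (le_trans ?_ hB) h12
    gcongr
  exact avgKernel_le_of_stiffSep (L := L) hβ hx hx' hU ha hω hrF hδ1 huv hC hP hsmall hm hτx' hτx hd hϑ1 hg₁ hBact

end Summit.QuantumFields.YangMills.Theorems.FemtoTransferGap.TwoLattice.ConstTube

end
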